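import Literature.Computability.Learning.NaturalLearningTables
import Literature.Computability.Complexity.ListFoldBricks
import Literature.Computability.Complexity.KannanLanguage
import Literature.Computability.MetaComplexity.MCSPProofs
import HarnessLib

/-!
# The table-based NW predictor in `FP`

Machine-layer instalment (M4) of the decomposition of the named fact
`Literature.Computability.Learning.cikk_natural_implies_learning` (CIKK 2016, Thm. 5.1): the
hypothesis evaluator's core, the NW predictor computed from the TABLES
(`NaturalLearningTables.lean`: `predictOfTables`, `nwPredictor_eq_predictOfTables`), as string
functions in the brick algebra. On the argument `⟨P, xbits⟩`,
`P = ⟨hdr, ⟨ibits, ⟨wbits, ⟨tables, zbits⟩⟩⟩⟩`, `hdr = ⟨pad, ⟨1^q, ⟨1^ℓ, ⟨1^{n'}, 1^L⟩⟩⟩⟩`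
(`ibits` the `ℓ` bits of the challenge block `i`, `wbits` the `L` advice bits, `tables` the
list code `body [T₀, …, T_{L-1}]` of the tables, `zbits` the seed):

* `colValFn` — the column value `A_v(τ) mod q` (`polyValFn`, `remFn`); `bitsOfFn` — the `ℓ`
  bits of a unary block index; `matchMaskFn` — the `n'`-bit indicator of the columns in which
  blocks `i` and `j` match (`colMatch`); `patFn` — the matching bits of `x` (the pattern, whose
  value is `idxOf`); `lookupFn` — `T_j[idx]`; `hybPiece`/`hybFn` — the `L` hybrid bits;
  `predFn dR` — the answer, `dR` the decision procedure of the property on truth tables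
  (a parameter: any `dR ∈ FP`);
* **`predFn_apply`**: on a genuine record, with `dR` deciding `truthTableLanguage R`, the value
  is `[nwPredictor (learnerDesign …) g (natTest R ℓ) i z w x]` whenever the stored tables are
  the `tableList`s of `g`.

## References

* M. Carmosino, R. Impagliazzo, V. Kabanets, A. Kolokolova, *Learning algorithms from natural
  proofs*, CCC 2016, §2.4 (NW reconstruction: circuit construction, steps 1–3)
  [CarmosinoImpagliazzoKabanetsKolokolova2016].
* S. Arora, B. Barak, *Computational Complexity: A Modern Approach*, CUP 2009, §1.3 [AroraBarakCC2009].
-/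

open Polynomial

namespace Literature.Computability.Learning

open Literature.Computability.Complexity Literature.Computability.Complexity.Brick
  Literature.Computability.Complexity.Plumb Literature.Computability.MetaComplexity
  Literature.Computability.Cryptography _root_.Computability

/-! ### Records -/

/-- The header `⟨pad, ⟨1^q, ⟨1^ℓ, ⟨1^{n'}, 1^L⟩⟩⟩⟩`. [folklore] -/
def predHdr (pad : List Bool) (q ℓ n' L : ℕ) : List Bool :=
  boolPair pad (boolPair (ones q) (boolPair (ones ℓ) (boolPair (ones n') (ones L))))

/-- The predictor's parameter record `⟨hdr, ⟨ibits, ⟨wbits, ⟨tables, zbits⟩⟩⟩⟩`. [folklore] -/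
def predRec (hdr ibits wbits tables zbits : List Bool) : List Bool :=
  boolPair hdr (boolPair ibits (boolPair wbits (boolPair tables zbits)))

/-! ### Column values and block bits -/

/-- From `⟨hdr, vbits⟩` to the design context `⟨pad, ⟨1^q, ⟨1^ℓ, ⟨vbits, ε⟩⟩⟩⟩`. [folklore] -/
noncomputable def mkCtxFn : List Bool → List Bool :=
  fanoutFn (nthF 0 ∘ fstF) (fanoutFn (nthF 1 ∘ fstF) (fanoutFn (nthF 2 ∘ fstF) (fanoutFn sndF (fun _ => []))))

/-- `mkCtxFn ∈ FP`. [folklore] -/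
theorem mkCtxFn_mem_FP : mkCtxFn ∈ FP :=
  fanoutFn_mem_FP (comp_mem_FP (nthF_mem_FP 0) fstF_mem_FP) (fanoutFn_mem_FP
    (comp_mem_FP (nthF_mem_FP 1) fstF_mem_FP) (fanoutFn_mem_FP (comp_mem_FP (nthF_mem_FP 2) fstF_mem_FP)
      (fanoutFn_mem_FP sndF_mem_FP (const_mem_FP _))))

/-- Value of `mkCtxFn`. [folklore] -/
@[simp] theorem mkCtxFn_apply (pad : List Bool) (q ℓ n' L : ℕ) (vbits : List Bool) :
    mkCtxFn (boolPair (predHdr pad q ℓ n' L) vbits) = designCtx pad q ℓ vbits [] := by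
  simp [mkCtxFn, predHdr, designCtx, nthF]

/-- **The column value** `A_v(τ) mod q` on `⟨⟨hdr, vbits⟩, 1^τ⟩` (binary numeral). [folklore] -/
noncomputable def colValFn : List Bool → List Bool :=
  remFn ∘ fanoutFn (polyValFn ∘ fanoutFn (mkCtxFn ∘ fstF) sndF) (lenBinF ∘ nthF 1 ∘ fstF ∘ fstF)

/-- `colValFn ∈ FP`. [folklore] -/
theorem colValFn_mem_FP : colValFn ∈ FP :=
  comp_mem_FP remFn_mem_FP (fanoutFn_mem_FP
    (comp_mem_FP polyValFn_mem_FP (fanoutFn_mem_FP (comp_mem_FP mkCtxFn_mem_FP fstF_mem_FP) sndF_mem_FP))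
    (comp_mem_FP lenBinF_mem_FP (comp_mem_FP (nthF_mem_FP 1) (comp_mem_FP fstF_mem_FP fstF_mem_FP))))

/-- Value of `colValFn`. [folklore] -/
theorem colValFn_apply (pad : List Bool) (q ℓ n' L : ℕ) (vbits : List Bool) (τ : ℕ) :
    colValFn (boolPair (boolPair (predHdr pad q ℓ n' L) vbits) (ones τ)) =
      encodeNat (polyValNat ℓ vbits τ % q) := by
  rw [colValFn, Function.comp_apply, fanoutFn_apply]
  simp only [Function.comp_apply, fanoutFn_apply, fstF_boolPair, sndF_boolPair, mkCtxFn_apply,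
    polyValFn_apply, remFn_boolPair, bitsToNat_encodeNat]
  have : nthF 1 (predHdr pad q ℓ n' L) = ones q := by simp [predHdr, nthF]
  rw [this, lenBinF_apply, bitsToNat_encodeNat]
  simp [ones, polyValNat]

/-- The `ℓ` bits (least significant first) of a unary index: `⟨1^ℓ, 1ʲ⟩ ↦ (encodeNat j ++ 0^ℓ) ↾ ℓ`.
[folklore] -/
noncomputable def bitsOfFn : List Bool → List Bool :=
  takeFn ∘ fanoutFn fstF (appF ∘ fanoutFn (lenBinF ∘ sndF) (Kannan.zerosFn ∘ fstF))

/-- `bitsOfFn ∈ FP`. [folklore] -/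
theorem bitsOfFn_mem_FP : bitsOfFn ∈ FP :=
  comp_mem_FP takeFn_mem_FP (fanoutFn_mem_FP fstF_mem_FP (comp_mem_FP appF_mem_FP
    (fanoutFn_mem_FP (comp_mem_FP lenBinF_mem_FP sndF_mem_FP) (comp_mem_FP Kannan.zerosFn_mem_FP fstF_mem_FP))))

/-- Padding a short list by `false`s and cutting at `ℓ` lists its entries read with default
`false`. [folklore] -/
theorem take_append_replicate_eq_ofFn (l : List Bool) (ℓ : ℕ) :
    (l ++ List.replicate ℓ false).take ℓ = List.ofFn fun r : Fin ℓ => l.getD r false := by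
  apply List.ext_getElem
  · simp only [List.length_take, List.length_append, List.length_replicate, List.length_ofFn]; omega
  · intro r h1 h2
    simp only [List.length_ofFn] at h2
    rw [List.getElem_take, List.getElem_ofFn, List.getElem_append]
    simp only [List.getD_eq_getElem?_getD]
    split_ifs with h
    · rw [List.getElem?_eq_getElem h]; rfl
    · rw [List.getElem?_eq_none (by omega), List.getElem_replicate]; rfl

/-- The low `ℓ` binary digits of `j`. [folklore] -/
theorem bitsOfFn_apply (ℓ j : ℕ) :
    bitsOfFn (boolPair (ones ℓ) (ones j)) = List.ofFn fun r : Fin ℓ => j.testBit r := by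
  rw [bitsOfFn, Function.comp_apply, fanoutFn_apply, takeFn_boolPair]
  simp only [Function.comp_apply, fanoutFn_apply, sndF_boolPair, fstF_boolPair, lenBinF_apply,
    Kannan.zerosFn_apply, appF_boolPair]
  rw [show (ones ℓ).length = ℓ by simp [ones], show (ones j).length = j by simp [ones],
    take_append_replicate_eq_ofFn]
  exact congrArg List.ofFn (funext fun r => (testBit_eq_getD_encodeNat j r).symm)

/-! ### The matching mask of blocks `i` and `j` -/

/-- The piece of the mask fold on `⟨⟨hdr, ⟨ibits, jbits⟩⟩, 1^τ⟩`: the bit `[A_i(τ) ≡ A_j(τ)]`.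
[folklore] -/
noncomputable def maskPiece : List Bool → List Bool :=
  eqValFn ∘ fanoutFn
    (colValFn ∘ fanoutFn (fanoutFn (fstF ∘ fstF) (nthF 1 ∘ fstF)) sndF)
    (colValFn ∘ fanoutFn (fanoutFn (fstF ∘ fstF) (sndPow 1 ∘ fstF)) sndF)

/-- `maskPiece ∈ FP`. [folklore] -/
theorem maskPiece_mem_FP : maskPiece ∈ FP :=
  comp_mem_FP eqValFn_mem_FP (fanoutFn_mem_FP
    (comp_mem_FP colValFn_mem_FP (fanoutFn_mem_FP
      (fanoutFn_mem_FP (comp_mem_FP fstF_mem_FP fstF_mem_FP) (comp_mem_FP (nthF_mem_FP 1) fstF_mem_FP)) sndF_mem_FP))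
    (comp_mem_FP colValFn_mem_FP (fanoutFn_mem_FP
      (fanoutFn_mem_FP (comp_mem_FP fstF_mem_FP fstF_mem_FP) (comp_mem_FP (sndPow_mem_FP 1) fstF_mem_FP)) sndF_mem_FP)))

/-- Value of `maskPiece`. [folklore] -/
theorem maskPiece_apply (pad : List Bool) (q ℓ n' L : ℕ) (ibits jbits : List Bool) (τ : ℕ) :
    maskPiece (boolPair (boolPair (predHdr pad q ℓ n' L) (boolPair ibits jbits)) (ones τ)) =
      [decide (polyValNat ℓ ibits τ % q = polyValNat ℓ jbits τ % q)] := by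
  rw [maskPiece, Function.comp_apply, fanoutFn_apply]
  simp only [Function.comp_apply, fanoutFn_apply, fstF_boolPair, sndF_boolPair, nthF, sndPow,
    colValFn_apply, eqValFn_boolPair, bitsToNat_encodeNat]

/-- The mask pieces are single bits (on every input, `eqValFn` is one-bit). [folklore] -/
theorem length_maskPiece (w : List Bool) : (maskPiece w).length = 1 := by
  rw [maskPiece, Function.comp_apply]
  exact oneBit_eqValFn.length_eq _

/-- **The matching mask** on `⟨hdr, ⟨ibits, jbits⟩⟩`: the `n'` bits `[A_i(τ) ≡ A_j(τ) (mod q)]`.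
[cite: CarmosinoImpagliazzoKabanetsKolokolova2016, §2.4] -/
noncomputable def matchMaskFn : List Bool → List Bool :=
  sndPow 2 ∘ foldLoop appF (clipF 1 maskPiece) X ∘
    fanoutFn id (fanoutFn (lenBinF ∘ nthF 3 ∘ fstF) (fun _ => boolPair [] []))

/-- `matchMaskFn ∈ FP`. [folklore] -/
theorem matchMaskFn_mem_FP : matchMaskFn ∈ FP :=
  comp_mem_FP (sndPow_mem_FP 2) (comp_mem_FP
    (foldLoop_clipF_mem_FP 1 appF_mem_FP length_appF_le maskPiece_mem_FP X)
    (fanoutFn_mem_FP (PolyTimeComputable.id _)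
      (fanoutFn_mem_FP (comp_mem_FP lenBinF_mem_FP (comp_mem_FP (nthF_mem_FP 3) fstF_mem_FP)) (const_mem_FP _))))

/-- Value of `matchMaskFn`. [folklore] -/
theorem matchMaskFn_apply (pad : List Bool) (q ℓ n' L : ℕ) (ibits jbits : List Bool) :
    matchMaskFn (boolPair (predHdr pad q ℓ n' L) (boolPair ibits jbits)) =
      ccat (fun τ => [decide (polyValNat ℓ ibits τ % q = polyValNat ℓ jbits τ % q)]) n' := by
  have hn : n' ≤ X.eval (boolPair (predHdr pad q ℓ n' L) (boolPair ibits jbits)).length := by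
    rw [eval_X, length_boolPair]
    have : n' ≤ (predHdr pad q ℓ n' L).length := by
      simp only [predHdr, length_boolPair]
      have : (ones n').length = n' := by simp [ones]
      omega
    omega
  have hnth : nthF 3 (predHdr pad q ℓ n' L) = ones n' := by simp [predHdr, nthF]
  rw [matchMaskFn, Function.comp_apply, Function.comp_apply, fanoutFn_apply, fanoutFn_apply, id,
    Function.comp_apply, Function.comp_apply, fstF_boolPair, hnth, lenBinF_apply,
    show (ones n').length = n' by simp [ones],
    show (boolPair ([] : List Bool) []) = boolPair (ones 0) ([] : List Bool) by rfl,
    foldLoop_apply _ _ hn, foldAcc_clipF (fun j _ _ => by rw [length_maskPiece]; omega), foldAcc_appF]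
  simp [sndPow, maskPiece_apply]

/-! ### The pattern of `x` and the table look-up -/

/-- The piece of the pattern fold on `⟨⟨mask, xbits⟩, 1^τ⟩`: `[x_τ]` if `mask_τ`, else `ε`.
[folklore] -/
noncomputable def patPiece : List Bool → List Bool :=
  iteFn (HashBricks.headBitFn ∘ bitAtFn ∘ fanoutFn sndF (fstF ∘ fstF))
    (bitAtFn ∘ fanoutFn sndF (sndF ∘ fstF)) (fun _ => [])

/-- `patPiece ∈ FP`. [folklore] -/
theorem patPiece_mem_FP : patPiece ∈ FP :=
  iteFn_mem_FP (comp_mem_FP HashBricks.headBitFn_mem_FP (comp_mem_FP bitAtFn_mem_FP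
    (fanoutFn_mem_FP sndF_mem_FP (comp_mem_FP fstF_mem_FP fstF_mem_FP))))
    (comp_mem_FP bitAtFn_mem_FP (fanoutFn_mem_FP sndF_mem_FP (comp_mem_FP sndF_mem_FP fstF_mem_FP)))
    (const_mem_FP _)

/-- Value of `patPiece`. [folklore] -/
theorem patPiece_apply (mask xbits : List Bool) (τ : ℕ) :
    patPiece (boolPair (boolPair mask xbits) (ones τ)) =
      if (mask.drop τ).headD false then (xbits.drop τ).take 1 else [] := by
  rw [patPiece, iteFn_apply (b := (mask.drop τ).headD false) (by
    simp only [Function.comp_apply, fanoutFn_apply, sndF_boolPair, fstF_boolPair, bitAtFn_boolPair,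
      HashBricks.headBitFn_apply, List.length_replicate, ones]
    cases mask.drop τ <;> simp)]
  simp [ones]

/-- **The pattern of `x`** on `⟨mask, xbits⟩`: the bits of `x` in the masked positions, in
order. [cite: CarmosinoImpagliazzoKabanetsKolokolova2016, §2.4] -/
noncomputable def patFn : List Bool → List Bool :=
  sndPow 2 ∘ foldLoop appF (clipF 1 patPiece) X ∘
    fanoutFn id (fanoutFn (lenBinF ∘ fstF) (fun _ => boolPair [] []))

/-- `patFn ∈ FP`. [folklore] -/
theorem patFn_mem_FP : patFn ∈ FP :=
  comp_mem_FP (sndPow_mem_FP 2) (comp_mem_FP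
    (foldLoop_clipF_mem_FP 1 appF_mem_FP length_appF_le patPiece_mem_FP X)
    (fanoutFn_mem_FP (PolyTimeComputable.id _)
      (fanoutFn_mem_FP (comp_mem_FP lenBinF_mem_FP fstF_mem_FP) (const_mem_FP _))))

/-- Value of `patFn`. [folklore] -/
theorem patFn_apply (mask xbits : List Bool) :
    patFn (boolPair mask xbits) =
      ccat (fun τ => if (mask.drop τ).headD false then (xbits.drop τ).take 1 else []) mask.length := by
  have hn : mask.length ≤ X.eval (boolPair mask xbits).length := by
    rw [eval_X, length_boolPair]; omega
  rw [patFn, Function.comp_apply, Function.comp_apply, fanoutFn_apply, fanoutFn_apply, id,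
    Function.comp_apply, fstF_boolPair, lenBinF_apply,
    show (boolPair ([] : List Bool) []) = boolPair (ones 0) ([] : List Bool) by rfl,
    foldLoop_apply _ _ hn, foldAcc_clipF (fun j _ _ => by
      rw [patPiece_apply]; split_ifs <;> simp), foldAcc_appF]
  simp [sndPow, patPiece_apply]

/-- **The table look-up** on `⟨⟨1^L, ⟨1ʲ, tables⟩⟩, patbits⟩`: bit `min(⟦patbits⟧, L)` of table
`j`. [cite: CarmosinoImpagliazzoKabanetsKolokolova2016, §2.4 (circuit construction, step 2)] -/
noncomputable def lookupFn : List Bool → List Bool :=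
  bitAtFn ∘ fanoutFn (binToUnaryFn ∘ fanoutFn (fstF ∘ fstF) sndF)
    (HashBricks.nthItemFn ∘ sndF ∘ fstF)

/-- `lookupFn ∈ FP`. [folklore] -/
theorem lookupFn_mem_FP : lookupFn ∈ FP :=
  comp_mem_FP bitAtFn_mem_FP (fanoutFn_mem_FP
    (comp_mem_FP binToUnaryFn_mem_FP (fanoutFn_mem_FP (comp_mem_FP fstF_mem_FP fstF_mem_FP) sndF_mem_FP))
    (comp_mem_FP HashBricks.nthItemFn_mem_FP (comp_mem_FP sndF_mem_FP fstF_mem_FP)))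

/-- Value of `lookupFn` on a list code of tables. [folklore] -/
theorem lookupFn_apply (L j : ℕ) (tbls : List (List Bool)) (patbits : List Bool) :
    lookupFn (boolPair (boolPair (ones L) (boolPair (ones j) (OracleCompose.body tbls))) patbits) =
      ((tbls.getD j []).drop (min (bitsToNat patbits) L)).take 1 := by
  rw [lookupFn, Function.comp_apply, fanoutFn_apply]
  simp only [Function.comp_apply, fanoutFn_apply, fstF_boolPair, sndF_boolPair, binToUnaryFn_boolPair,
    HashBricks.nthItemFn_body, bitAtFn_boolPair]
  simp [ones]

/-! ### The hybrid string and the predictor -/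

section Accessors

/-- Accessor (piece argument `⟨⟨P, xbits⟩, 1ʲ⟩`): the record `P`. [folklore] -/
noncomputable def PofW : List Bool → List Bool := fstF ∘ fstF
/-- Accessor: the header. [folklore] -/
noncomputable def hdrW : List Bool → List Bool := fstF ∘ PofW
/-- Accessor: `1^L`. [folklore] -/
noncomputable def onesLW : List Bool → List Bool := sndPow 3 ∘ hdrW
/-- Accessor: `1^ℓ`. [folklore] -/
noncomputable def onesEllW : List Bool → List Bool := nthF 2 ∘ hdrW
/-- Accessor: `ibits`. [folklore] -/
noncomputable def ibitsW : List Bool → List Bool := nthF 1 ∘ PofW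
/-- Accessor: `wbits`. [folklore] -/
noncomputable def wbitsW : List Bool → List Bool := nthF 2 ∘ PofW
/-- Accessor: `tables`. [folklore] -/
noncomputable def tablesW : List Bool → List Bool := nthF 3 ∘ PofW
/-- Accessor: `xbits`. [folklore] -/
noncomputable def xbitsW : List Bool → List Bool := sndF ∘ fstF
/-- Accessor: `1ⁱ` (from `ibits`, capped at `L`). [folklore] -/
noncomputable def onesiW : List Bool → List Bool := binToUnaryFn ∘ fanoutFn onesLW ibitsW
/-- Accessor: the `ℓ` bits of `j`. [folklore] -/
noncomputable def jbitsW : List Bool → List Bool := bitsOfFn ∘ fanoutFn onesEllW sndF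

/-- The accessors are in `FP`. [folklore] -/
theorem accessors_mem_FP :
    PofW ∈ FP ∧ hdrW ∈ FP ∧ onesLW ∈ FP ∧ onesEllW ∈ FP ∧ ibitsW ∈ FP ∧ wbitsW ∈ FP ∧
      tablesW ∈ FP ∧ xbitsW ∈ FP ∧ onesiW ∈ FP ∧ jbitsW ∈ FP := by
  have hP : PofW ∈ FP := comp_mem_FP fstF_mem_FP fstF_mem_FP
  have hH : hdrW ∈ FP := comp_mem_FP fstF_mem_FP hP
  have hL : onesLW ∈ FP := comp_mem_FP (sndPow_mem_FP 3) hH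
  have hE : onesEllW ∈ FP := comp_mem_FP (nthF_mem_FP 2) hH
  have hI : ibitsW ∈ FP := comp_mem_FP (nthF_mem_FP 1) hP
  refine ⟨hP, hH, hL, hE, hI, comp_mem_FP (nthF_mem_FP 2) hP, comp_mem_FP (nthF_mem_FP 3) hP,
    comp_mem_FP sndF_mem_FP fstF_mem_FP, comp_mem_FP binToUnaryFn_mem_FP (fanoutFn_mem_FP hL hI),
    comp_mem_FP bitsOfFn_mem_FP (fanoutFn_mem_FP hE sndF_mem_FP)⟩

end Accessors

/-- **The piece of the hybrid fold** at index `j`: a table look-up at the pattern of `x` for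
`j < i`, the advice bit `w_j` for `j ≥ i`. [cite: CarmosinoImpagliazzoKabanetsKolokolova2016, §2.4 (circuit construction)] -/
noncomputable def hybPiece : List Bool → List Bool :=
  iteFn (ltLenF ∘ fanoutFn sndF onesiW)
    (lookupFn ∘ fanoutFn (fanoutFn onesLW (fanoutFn sndF tablesW))
      (patFn ∘ fanoutFn (matchMaskFn ∘ fanoutFn hdrW (fanoutFn ibitsW jbitsW)) xbitsW))
    (bitAtFn ∘ fanoutFn sndF wbitsW)

/-- `hybPiece ∈ FP`. [folklore] -/
theorem hybPiece_mem_FP : hybPiece ∈ FP := by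
  obtain ⟨-, hH, hL, -, hI, hW, hT, hX, hi, hj⟩ := accessors_mem_FP
  exact iteFn_mem_FP (comp_mem_FP ltLenF_mem_FP (fanoutFn_mem_FP sndF_mem_FP hi))
    (comp_mem_FP lookupFn_mem_FP (fanoutFn_mem_FP (fanoutFn_mem_FP hL (fanoutFn_mem_FP sndF_mem_FP hT))
      (comp_mem_FP patFn_mem_FP (fanoutFn_mem_FP
        (comp_mem_FP matchMaskFn_mem_FP (fanoutFn_mem_FP hH (fanoutFn_mem_FP hI hj))) hX))))
    (comp_mem_FP bitAtFn_mem_FP (fanoutFn_mem_FP sndF_mem_FP hW))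

/-- **Value of `hybPiece`** on a genuine argument (`⟦ibits⟧ < L`, `j < 2^ℓ`). [folklore] -/
theorem hybPiece_apply (pad : List Bool) (q ℓ n' L : ℕ) (ibits wbits : List Bool) (tbls : List (List Bool))
    (zbits xbits : List Bool) (hi : bitsToNat ibits < L) (j : ℕ) :
    hybPiece (boolPair (boolPair (predRec (predHdr pad q ℓ n' L) ibits wbits (OracleCompose.body tbls) zbits)
      xbits) (ones j)) =
      if j < bitsToNat ibits then
        ((tbls.getD j []).drop (min (bitsToNat (patFn (boolPair
          (matchMaskFn (boolPair (predHdr pad q ℓ n' L) (boolPair ibits (List.ofFn fun r : Fin ℓ => j.testBit r))))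
          xbits))) L)).take 1
      else (wbits.drop j).take 1 := by
  have hacc : ∀ u : List Bool,
      let w := boolPair (boolPair (predRec (predHdr pad q ℓ n' L) ibits wbits (OracleCompose.body tbls) zbits)
        xbits) u
      PofW w = predRec (predHdr pad q ℓ n' L) ibits wbits (OracleCompose.body tbls) zbits ∧
      hdrW w = predHdr pad q ℓ n' L ∧ onesLW w = ones L ∧ onesEllW w = ones ℓ ∧ ibitsW w = ibits ∧
      wbitsW w = wbits ∧ tablesW w = OracleCompose.body tbls ∧ xbitsW w = xbits ∧ onesiW w = ones (bitsToNat ibits) := by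
    intro u
    simp only [PofW, hdrW, onesLW, onesEllW, ibitsW, wbitsW, tablesW, xbitsW, onesiW, Function.comp_apply,
      fanoutFn_apply, fstF_boolPair, sndF_boolPair, predRec, predHdr, nthF, sndPow, binToUnaryFn_boolPair,
      List.length_replicate, ones, min_eq_left hi.le, and_self]
  obtain ⟨hP, hH, hL, hE, hI, hW, hT, hX, hii⟩ := hacc (ones j)
  have hjb : jbitsW (boolPair (boolPair (predRec (predHdr pad q ℓ n' L) ibits wbits (OracleCompose.body tbls) zbits)
      xbits) (ones j)) = List.ofFn fun r : Fin ℓ => j.testBit r := by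
    rw [jbitsW, Function.comp_apply, fanoutFn_apply, hE, sndF_boolPair, bitsOfFn_apply]
  rw [hybPiece, iteFn_apply (b := decide (j < bitsToNat ibits)) (by
    rw [Function.comp_apply, fanoutFn_apply, sndF_boolPair, hii, ltLenF_boolPair]
    simp [ones])]
  by_cases hlt : j < bitsToNat ibits
  · rw [if_pos hlt, decide_eq_true hlt]
    simp only [ite_true, Function.comp_apply, fanoutFn_apply, hL, sndF_boolPair, hT, hH, hI, hjb, hX,
      lookupFn_apply]
  · rw [if_neg hlt, decide_eq_false hlt]
    simp only [Function.comp_apply, fanoutFn_apply, sndF_boolPair, hW, bitAtFn_boolPair,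
      List.length_replicate, ones, Bool.false_eq_true, ite_false]

/-- The hybrid pieces are at most one bit long on every input. [folklore] -/
theorem length_hybPiece_le (w : List Bool) : (hybPiece w).length ≤ 1 := by
  rw [hybPiece, iteFn_of_oneBit (oneBit_ltLenF.comp _)]
  split_ifs
  · rw [Function.comp_apply, lookupFn]
    simp only [Function.comp_apply, fanoutFn_apply, bitAtFn_boolPair]
    exact List.length_take_le _ _
  · rw [Function.comp_apply]
    simp only [fanoutFn_apply, bitAtFn_boolPair]
    exact List.length_take_le _ _

/-- **The hybrid string** on `Π = ⟨P, xbits⟩`: the `L` bits `H_j`, `j < L`.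
[cite: CarmosinoImpagliazzoKabanetsKolokolova2016, §2.4 (circuit construction)] -/
noncomputable def hybFn : List Bool → List Bool :=
  sndPow 2 ∘ foldLoop appF (clipF 1 hybPiece) X ∘
    fanoutFn id (fanoutFn (lenBinF ∘ sndPow 3 ∘ fstF ∘ fstF) (fun _ => boolPair [] []))

/-- `hybFn ∈ FP`. [folklore] -/
theorem hybFn_mem_FP : hybFn ∈ FP :=
  comp_mem_FP (sndPow_mem_FP 2) (comp_mem_FP
    (foldLoop_clipF_mem_FP 1 appF_mem_FP length_appF_le hybPiece_mem_FP X)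
    (fanoutFn_mem_FP (PolyTimeComputable.id _)
      (fanoutFn_mem_FP (comp_mem_FP lenBinF_mem_FP (comp_mem_FP (sndPow_mem_FP 3)
        (comp_mem_FP fstF_mem_FP fstF_mem_FP))) (const_mem_FP _))))

/-- Value of `hybFn`: the concatenation of the hybrid pieces. [folklore] -/
theorem hybFn_apply (pad : List Bool) (q ℓ n' L : ℕ) (ibits wbits tables zbits xbits : List Bool) :
    hybFn (boolPair (predRec (predHdr pad q ℓ n' L) ibits wbits tables zbits) xbits) =
      ccat (fun j => hybPiece (boolPair (boolPair (predRec (predHdr pad q ℓ n' L) ibits wbits tables zbits)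
        xbits) (ones j))) L := by
  have hL : L ≤ X.eval (boolPair (predRec (predHdr pad q ℓ n' L) ibits wbits tables zbits) xbits).length := by
    rw [eval_X, length_boolPair]
    have : L ≤ (predRec (predHdr pad q ℓ n' L) ibits wbits tables zbits).length := by
      simp only [predRec, predHdr, length_boolPair]
      have : (ones L).length = L := by simp [ones]
      omega
    omega
  have hnth : sndPow 3 (fstF (predRec (predHdr pad q ℓ n' L) ibits wbits tables zbits)) = ones L := by
    simp [predRec, predHdr, sndPow]
  rw [hybFn, Function.comp_apply, Function.comp_apply, fanoutFn_apply, fanoutFn_apply, id,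
    Function.comp_apply, Function.comp_apply, Function.comp_apply, fstF_boolPair, hnth, lenBinF_apply,
    show (ones L).length = L by simp [ones],
    show (boolPair ([] : List Bool) []) = boolPair (ones 0) ([] : List Bool) by rfl,
    foldLoop_apply _ _ hL, foldAcc_clipF (fun j _ _ => (length_hybPiece_le _).trans (by omega)), foldAcc_appF]
  simp [sndPow]

/-- The advice bit `w_i` on `Π` (one bit on every input). [folklore] -/
noncomputable def wiFn : List Bool → List Bool :=
  HashBricks.headBitFn ∘ bitAtFn ∘ fanoutFn
    (binToUnaryFn ∘ fanoutFn (sndPow 3 ∘ fstF ∘ fstF) (nthF 1 ∘ fstF)) (nthF 2 ∘ fstF)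

/-- `wiFn ∈ FP`. [folklore] -/
theorem wiFn_mem_FP : wiFn ∈ FP :=
  comp_mem_FP HashBricks.headBitFn_mem_FP (comp_mem_FP bitAtFn_mem_FP (fanoutFn_mem_FP
    (comp_mem_FP binToUnaryFn_mem_FP (fanoutFn_mem_FP
      (comp_mem_FP (sndPow_mem_FP 3) (comp_mem_FP fstF_mem_FP fstF_mem_FP)) (comp_mem_FP (nthF_mem_FP 1) fstF_mem_FP)))
    (comp_mem_FP (nthF_mem_FP 2) fstF_mem_FP)))

/-- Value of `wiFn`. [folklore] -/
theorem wiFn_apply (pad : List Bool) (q ℓ n' L : ℕ) (ibits wbits tables zbits xbits : List Bool)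
    (hi : bitsToNat ibits < L) :
    wiFn (boolPair (predRec (predHdr pad q ℓ n' L) ibits wbits tables zbits) xbits) =
      [(wbits.drop (bitsToNat ibits)).headD false] := by
  rw [wiFn, Function.comp_apply, Function.comp_apply, fanoutFn_apply]
  simp only [Function.comp_apply, fanoutFn_apply, fstF_boolPair, predRec, predHdr, nthF, sndPow,
    sndF_boolPair, binToUnaryFn_boolPair, List.length_replicate, ones, min_eq_left hi.le, bitAtFn_boolPair,
    HashBricks.headBitFn_apply]
  cases wbits.drop (bitsToNat ibits) <;> simp

/-- `wiFn` is one-bit on every input. [folklore] -/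
theorem oneBit_wiFn : OneBit wiFn := fun w => ⟨_, by rw [wiFn, Function.comp_apply, HashBricks.headBitFn_apply]⟩

/-- **The table-based NW predictor** with the decision procedure `dR` of the property on truth
tables: answer `¬ w_i` if `dR` accepts the hybrid string (the test `natTest` REJECTS strings with
the property), `w_i` otherwise. [cite: CarmosinoImpagliazzoKabanetsKolokolova2016, §2.4 (circuit construction, step 3)] -/
noncomputable def predFn (dR : List Bool → List Bool) : List Bool → List Bool :=
  iteFn (HashBricks.headBitFn ∘ dR ∘ hybFn) (notFn wiFn) wiFn

/-- **`predFn dR ∈ FP`** for `dR ∈ FP`. [cite: AroraBarakCC2009, §1.3] -/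
theorem predFn_mem_FP {dR : List Bool → List Bool} (hdR : dR ∈ FP) : predFn dR ∈ FP :=
  iteFn_mem_FP (comp_mem_FP HashBricks.headBitFn_mem_FP (comp_mem_FP hdR hybFn_mem_FP))
    (notFn_mem_FP wiFn_mem_FP) wiFn_mem_FP

/-- `predFn dR` is one-bit on every input. [folklore] -/
theorem oneBit_predFn (dR : List Bool → List Bool) : OneBit (predFn dR) :=
  ((HashBricks.oneBit_headBitFn).comp _).ite (oneBit_notFn oneBit_wiFn) oneBit_wiFn

/-- **Value of `predFn`** (string level): negate `w_i` iff `dR` accepts the hybrid string. [folklore] -/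
theorem predFn_apply_str (dR : List Bool → List Bool) (pad : List Bool) (q ℓ n' L : ℕ)
    (ibits wbits tables zbits xbits : List Bool) (hi : bitsToNat ibits < L) :
    predFn dR (boolPair (predRec (predHdr pad q ℓ n' L) ibits wbits tables zbits) xbits) =
      [xor ((dR (hybFn (boolPair (predRec (predHdr pad q ℓ n' L) ibits wbits tables zbits) xbits))).headD false)
        ((wbits.drop (bitsToNat ibits)).headD false)] := by
  rw [predFn, iteFn_apply (b := (dR (hybFn (boolPair (predRec (predHdr pad q ℓ n' L) ibits wbits tables zbits)
      xbits))).headD false) (by rw [Function.comp_apply, Function.comp_apply, HashBricks.headBitFn_apply])]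
  split_ifs with h
  · rw [notFn_apply (wiFn_apply pad q ℓ n' L ibits wbits tables zbits xbits hi), h]
    simp
  · rw [wiFn_apply pad q ℓ n' L ibits wbits tables zbits xbits hi]
    simp only [Bool.not_eq_true] at h
    rw [h]
    simp

/-! ### The bridge to the mathematical predictor -/

open MCSPVerif in
/-- `bitsToNat` of the bits of a cube point is its index in the standard enumeration. [folklore] -/
theorem bitsToNat_ofFn_symm {ℓ : ℕ} (i : Fin (2 ^ ℓ)) :
    bitsToNat (List.ofFn ((boolFunEquivFin ℓ).symm i)) = i := by
  apply Nat.eq_of_testBit_eq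
  intro r
  rw [Com.testBit_bitsToNat, boolFunEquivFin_symm_apply]
  by_cases hr : r < ℓ
  · rw [List.getD_eq_getElem _ _ (by simpa using hr), List.getElem_ofFn, lowBits_apply]
  · rw [List.getD_eq_default _ _ (by simpa using hr)]
    symm
    exact Nat.testBit_lt_two_pow (lt_of_lt_of_le i.isLt (Nat.pow_le_pow_right (by norm_num) (not_lt.1 hr)))

open MCSPVerif in
/-- The low `ℓ` bits of `j < 2^ℓ` are the bits of the cube point of index `j`. [folklore] -/
theorem ofFn_testBit_eq {ℓ j : ℕ} (hj : j < 2 ^ ℓ) :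
    (List.ofFn fun r : Fin ℓ => j.testBit r) = List.ofFn ((boolFunEquivFin ℓ).symm ⟨j, hj⟩) := by
  rw [boolFunEquivFin_symm_apply]
  exact congrArg List.ofFn (funext fun r => (lowBits_apply ℓ j r).symm)

/-- A concatenation of conditional singletons is a filtered map. [folklore] -/
theorem ccat_ite_eq_filter_map (P : ℕ → Prop) [DecidablePred P] (f : ℕ → Bool) :
    ∀ m : ℕ, ccat (fun τ => if P τ then [f τ] else []) m = ((List.range m).filter fun τ => decide (P τ)).map f
  | 0 => by simp
  | m + 1 => by
    rw [ccat_succ, ccat_ite_eq_filter_map P f m, List.range_succ, List.filter_append, List.map_append]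
    congr 1
    by_cases h : P m <;> simp [h]

/-- Reading entry `τ < m` of an `ofFn` after dropping. [folklore] -/
theorem headD_drop_ofFn {m : ℕ} (v : Fin m → Bool) {τ : ℕ} (hτ : τ < m) :
    ((List.ofFn v).drop τ).headD false = v ⟨τ, hτ⟩ := by
  rw [List.headD_eq_head?_getD, List.head?_drop, List.getElem?_eq_getElem (by simpa using hτ),
    List.getElem_ofFn]
  rfl

/-- The first entry after dropping `τ < m` symbols of an `ofFn`. [folklore] -/
theorem take_one_drop_ofFn {m : ℕ} (v : Fin m → Bool) {τ : ℕ} (hτ : τ < m) :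
    ((List.ofFn v).drop τ).take 1 = [v ⟨τ, hτ⟩] := by
  rw [List.take_one_drop_eq_of_lt_length (by simpa using hτ), List.get_ofFn]
  rfl

/-- The hybrid bits of the table-based predictor, as a function. [folklore] -/
noncomputable def hybOfTables {q n k ℓ : ℕ} [Fact q.Prime] (hn : k * n + k ≤ q) (g : (Fin (k * n + k) → Bool) → Bool)
    (i : Fin (2 ^ ℓ)) (z : Fin (q * q) → Bool) (w : Fin (2 ^ ℓ) → Bool) (x : Fin (k * n + k) → Bool) :
    Fin (2 ^ ℓ) → Bool :=
  fun j => if (j : ℕ) < i then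
    (tableList (learnerDesign q n k ℓ hn) g q i j z).getD (idxOf q ℓ (k * n + k) i j x) false else w j

/-- **Each hybrid piece of the machine is the hybrid bit.** [cite: CarmosinoImpagliazzoKabanetsKolokolova2016, §2.4] -/
theorem hybPiece_eq {q n k ℓ : ℕ} [Fact q.Prime] (hn : k * n + k ≤ q) (pad : List Bool)
    (g : (Fin (k * n + k) → Bool) → Bool) (i : Fin (2 ^ ℓ)) (z : Fin (q * q) → Bool)
    (w : Fin (2 ^ ℓ) → Bool) (x : Fin (k * n + k) → Bool) (tbls : List (List Bool))
    (htbls : ∀ j : Fin (2 ^ ℓ), (j : ℕ) < i → tbls.getD j [] = tableList (learnerDesign q n k ℓ hn) g q i j z)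
    (j : ℕ) (hj : j < 2 ^ ℓ) :
    hybPiece (boolPair (boolPair (predRec (predHdr pad q ℓ (k * n + k) (2 ^ ℓ))
      (List.ofFn ((boolFunEquivFin ℓ).symm i)) (List.ofFn w) (OracleCompose.body tbls) (List.ofFn z))
      (List.ofFn x)) (ones j)) = [hybOfTables hn g i z w x ⟨j, hj⟩] := by
  classical
  have hival : bitsToNat (List.ofFn ((boolFunEquivFin ℓ).symm i)) = i := bitsToNat_ofFn_symm i
  have hi : bitsToNat (List.ofFn ((boolFunEquivFin ℓ).symm i)) < 2 ^ ℓ := by rw [hival]; exact i.isLt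
  rw [hybPiece_apply pad q ℓ (k * n + k) (2 ^ ℓ) _ (List.ofFn w) tbls (List.ofFn z) (List.ofFn x) hi j, hival]
  unfold hybOfTables
  by_cases hji : j < (i : ℕ)
  · rw [if_pos hji]
    simp only [hji, if_true]
    have hne : i ≠ ⟨j, hj⟩ := fun h => by rw [h] at hji; exact lt_irrefl _ hji
    -- the mask is the matching indicator
    have hmask : matchMaskFn (boolPair (predHdr pad q ℓ (k * n + k) (2 ^ ℓ))
        (boolPair (List.ofFn ((boolFunEquivFin ℓ).symm i)) (List.ofFn fun r : Fin ℓ => j.testBit r))) =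
        List.ofFn fun τ : Fin (k * n + k) => decide (colMatch q ℓ i ⟨j, hj⟩ τ) := by
      rw [matchMaskFn_apply, ofFn_testBit_eq hj]
      exact ccat_singleton_eq_ofFn (fun τ => decide (colMatch q ℓ i ⟨j, hj⟩ τ)) (k * n + k)
    -- the pattern value is `idxOf`
    have hpat : bitsToNat (patFn (boolPair (matchMaskFn (boolPair (predHdr pad q ℓ (k * n + k) (2 ^ ℓ))
        (boolPair (List.ofFn ((boolFunEquivFin ℓ).symm i)) (List.ofFn fun r : Fin ℓ => j.testBit r))))
        (List.ofFn x))) = idxOf q ℓ (k * n + k) i ⟨j, hj⟩ x := by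
      rw [hmask, patFn_apply, List.length_ofFn,
        ccat_congr (g' := fun τ => if colMatch q ℓ i ⟨j, hj⟩ τ then [(List.ofFn x).getD τ false] else [])
          (fun τ hτ => by
            rw [headD_drop_ofFn _ hτ]
            by_cases hc : colMatch q ℓ i ⟨j, hj⟩ τ
            · simp [hc, take_one_drop_ofFn _ hτ, hτ]
            · simp [hc]),
        ccat_ite_eq_filter_map, idxOf]
      congr 1
      rw [← List.map_coe_finRange_eq_range, List.filter_map, List.map_map]
      congr 1
      funext τ
      simp
    rw [hpat, htbls ⟨j, hj⟩ hji]
    have hidx : idxOf q ℓ (k * n + k) i ⟨j, hj⟩ x <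
        (tableList (learnerDesign q n k ℓ hn) g q i ⟨j, hj⟩ z).length := by
      rw [tableList, List.length_ofFn]; exact idxOf_lt i ⟨j, hj⟩ x
    have hidxL : idxOf q ℓ (k * n + k) i ⟨j, hj⟩ x ≤ 2 ^ ℓ :=
      (idxOf_lt i ⟨j, hj⟩ x).le.trans (Nat.pow_le_pow_right (by norm_num) (card_matching_le hn hne))
    rw [min_eq_left hidxL, List.take_one_drop_eq_of_lt_length hidx, List.getD_eq_getElem _ _ hidx]
    rfl
  · rw [if_neg hji]
    simp only [hji, if_false]
    exact take_one_drop_ofFn w hj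

/-- **The machine predictor is the NW predictor.** On the record of the challenge block `i` (its
`ℓ` bits), the advice `w`, the list code of tables whose `j`-th item is the table
`tableList … i j z` of block `j`, and the seed, with `dR` deciding the property on truth tables
(`dR y = encodeBool [y ∈ truthTableLanguage R]`, the format of `indicatorFn_mem_FP`),
`predFn dR ⟨P, x⟩ = [nwPredictor (learnerDesign …) g (natTest R ℓ) i z w x]`.
[cite: CarmosinoImpagliazzoKabanetsKolokolova2016, Thm. 2.11 (reconstruction algorithm)] -/
theorem predFn_eq_nwPredictor {q n k ℓ : ℕ} [Fact q.Prime] (hn : k * n + k ≤ q) (R : CombinatorialProperty)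
    {dR : List Bool → List Bool} (hdR : ∀ y, dR y = encodeBool ((truthTableLanguage R).boolIndicator y))
    (pad : List Bool) (g : (Fin (k * n + k) → Bool) → Bool) (i : Fin (2 ^ ℓ)) (z : Fin (q * q) → Bool)
    (w : Fin (2 ^ ℓ) → Bool) (x : Fin (k * n + k) → Bool) (tbls : List (List Bool))
    (htbls : ∀ j : Fin (2 ^ ℓ), (j : ℕ) < i → tbls.getD j [] = tableList (learnerDesign q n k ℓ hn) g q i j z) :
    predFn dR (boolPair (predRec (predHdr pad q ℓ (k * n + k) (2 ^ ℓ))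
      (List.ofFn ((boolFunEquivFin ℓ).symm i)) (List.ofFn w) (OracleCompose.body tbls) (List.ofFn z))
      (List.ofFn x)) = [nwPredictor (learnerDesign q n k ℓ hn) g (natTest R ℓ) i z w x] := by
  classical
  have hival : bitsToNat (List.ofFn ((boolFunEquivFin ℓ).symm i)) = i := bitsToNat_ofFn_symm i
  have hi : bitsToNat (List.ofFn ((boolFunEquivFin ℓ).symm i)) < 2 ^ ℓ := by rw [hival]; exact i.isLt
  -- the hybrid string is `ofFn hyb`
  have hstr : hybFn (boolPair (predRec (predHdr pad q ℓ (k * n + k) (2 ^ ℓ)) (List.ofFn ((boolFunEquivFin ℓ).symm i))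
      (List.ofFn w) (OracleCompose.body tbls) (List.ofFn z)) (List.ofFn x)) = List.ofFn (hybOfTables hn g i z w x) := by
    rw [hybFn_apply, ccat_congr (g' := fun j => [if h : j < 2 ^ ℓ then hybOfTables hn g i z w x ⟨j, h⟩ else false])
      (fun j hj => by rw [hybPiece_eq hn pad g i z w x tbls htbls j hj, dif_pos hj]), ccat_singleton_eq_ofFn]
    exact congrArg List.ofFn (funext fun j => by rw [dif_pos j.isLt])
  rw [predFn_apply_str dR pad q ℓ (k * n + k) (2 ^ ℓ) _ (List.ofFn w) (OracleCompose.body tbls) (List.ofFn z)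
    (List.ofFn x) hi, hstr, hdR, hival, headD_drop_ofFn w i.isLt,
    nwPredictor_eq_predictOfTables hn (natTest R ℓ) i z w x g]
  have hmem : (List.ofFn (hybOfTables hn g i z w x) ∈ truthTableLanguage R) ↔
      (hybOfTables hn g i z w x ∘ boolFunEquivFin ℓ) ∈ R ℓ := by
    rw [← truthTable_comp_boolFunEquivFin, truthTable_mem_truthTableLanguage_iff]
  rw [show predictOfTables (natTest R ℓ) i (fun j => tableList (learnerDesign q n k ℓ hn) g q i j z)
      (fun j => idxOf q ℓ (k * n + k) i j x) w =
      (if natTest R ℓ (hybOfTables hn g i z w x) = true then w i else !(w i)) from rfl]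
  have henc : ∀ b : Bool, (encodeBool b).headD false = b := fun b => by cases b <;> rfl
  rw [henc]
  unfold natTest
  by_cases hm : (hybOfTables hn g i z w x ∘ boolFunEquivFin ℓ) ∈ R ℓ
  · rw [(Set.mem_iff_boolIndicator _ _).1 (hmem.2 hm), (propertyTest_eq_true_iff R ℓ _).2 hm]
    simp
  · have h1 : (truthTableLanguage R).boolIndicator (List.ofFn (hybOfTables hn g i z w x)) = false := by
      cases hb : (truthTableLanguage R).boolIndicator (List.ofFn (hybOfTables hn g i z w x))
      · rfl
      · exact absurd (hmem.1 ((Set.mem_iff_boolIndicator _ _).2 hb)) hm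
    have h2 : propertyTest R ℓ (hybOfTables hn g i z w x ∘ boolFunEquivFin ℓ) = false := by
      cases hpt : propertyTest R ℓ (hybOfTables hn g i z w x ∘ boolFunEquivFin ℓ)
      · rfl
      · exact absurd ((propertyTest_eq_true_iff R ℓ _).1 hpt) hm
    rw [h1, h2]
    simp

end Literature.Computability.Learning
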